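import Summits.AtomisticToContinuum.Crystallization.Theorems.ChargedEnergyGapKinkBudgetA
import HarnessLib

/-!
# ChargedEnergyGap · NODE 84 «KinkBudget» (lens-3 g83) — file B of three: TABLE CERTIFICATES, THE RESIDUAL LEAF (F₃), AND (F_lo) ⟸ (F₂¹⁰) ∧ (F₃) PROVED

Line of record `stmt-AtomisticToContinuum-14231` (`Summit.AtomisticToContinuum.ChargedEnergyGap`), route PricedLinkCensus.  File A (`…KinkBudgetA`) proved the
kink budget of a marked fibre: at most THREE marked holes, the pair budget, the three-hole budget `m₂k₂ + m₁(k₁ − 1) + m₃(k₃ − 1) ≤ 160`.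

THIS FILE.  §B1 KERNEL-CHECKED TABLE CERTIFICATES over the inherited tables `capKRows` (NODE 81) and `lineExcessRows` (NODE 82) — Boolean
certificates `kbCellLe r c M` («every entry of `capKRows` in rows `≤ r`, columns `≤ c` is `≤ M`») decided by the kernel (`decide +kernel`: structural
list recursion and exact rational comparison; standard axioms only, no `native_decide`), and their real-valued consequences: column `≤ 2 ⇒ capK ≤ 8.4`,
column `≤ 3 ⇒ capK ≤ 11`, min-depth `< 104.5 ⇒ capK ≤ 2.4`, and for key columns `j = 2 … 9`: column `≤ j ⇒ capK ≤ E(j, 2)` (the two-hole line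
excess dominates the cumulative column maximum `8.4, 11, 15.6, 17.5, 21.8, 25.3, 33.3, 42 ≤ 9.2, 11.9, 16.7, 18.7, 23.2, 26.9, 35.3, 44.3`); the three
values `E(2,3) = 18`, `E(7…9, 3) ≥ 26.9`, `E(10,2) = 2.6`.  §B2 the two residual statements (F₂¹⁰) `FibreChargeTwoTenQ` (two holes, key column `10`;
PROVED in file C by the discrete parabola) and ★ (F₃) `FibreChargeThreeMidQ` (three holes, key column `3 … 6`; the residual TABLE leaf of NODE 84).
§B3 the case analysis: sums over `1, 2, 3` marked positions split off the key (`kb_sum_two`, `kb_sum_three`), the three relative positions of the key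
among three holes turned into three budget inequalities (`kb_three_positions`), regime I (`kb_three_nonkey_le`: key column `≥ 7 ⇒` the two non-key
holes carry `≤ 22`) and regime II (`kb_three_absurd`: key column `≥ 10` and three holes is impossible), and ★★★ `fibreChargeLowQ_of_kinkBudget` :
(F_lo) ⟸ (F₂¹⁰) ∧ (F₃) PROVED — one hole: trivial; two holes: key column `≤ 9` by the cumulative column maximum, `= 10` is (F₂¹⁰); three holes: key
column `2` by `2 × 8.4 ≤ 18`, `3 … 6` is (F₃), `7 … 9` by regime I (`22 ≤ 26.9`), `10` by regime II; four or more holes: excluded by file A.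

Imports ONLY `…ChargedEnergyGapKinkBudgetA` and `HarnessLib`; no `set_option`, no `sorry`, no instance, no notation, no `private`; namespace
`…Theorems.ChargedEnergyGapChartDial`; new names `kb*`, `FibreChargeTwoTenQ`, `FibreChargeThreeMidQ`, `fibreChargeLowQ_of_kinkBudget`.
-/

noncomputable section

open scoped Classical
open Literature.MathematicalPhysics.StatisticalMechanics Literature.Geometry.DiscreteGeometry
open Summit.AtomisticToContinuum.Crystallization.Theses.PricedLinkCensus
open Summit.AtomisticToContinuum.Crystallization.Theorems.ChargedEnergyGapNegative

namespace Summit.AtomisticToContinuum.Crystallization.Theorems.ChargedEnergyGapChartDial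

/-! ## §B1 Kernel-checked table certificates -/

section Tables

/-- CERTIFICATE SHAPE: every entry of the kink–cost table `capKRows` in rows `0 … rmax` and columns `0 … cmax` is `≤ M` (a Boolean, decided by
the kernel). -/
def kbCellLe (rmax cmax : ℕ) (M : ℚ) : Bool :=
  (List.range (rmax + 1)).all fun r => (List.range (cmax + 1)).all fun c => decide ((capKRows.getD r []).getD c 0 ≤ M)

/-- CERTIFICATE SHAPE: for the key columns `j = 2 … 9` the entries of `capKRows` in columns `≤ j` are `≤ E(j, 2) = lineExcessRows[0][j]`. -/
def kbCum : Bool :=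
  (List.range 8).all fun i => kbCellLe 74 (i + 2) ((lineExcessRows.getD 0 []).getD (i + 2) 0)

/-- Certificate: columns `≤ 2` carry `≤ 8.4`. [kernel decision] -/
theorem kbCol2_true : kbCellLe 74 2 (42 / 5) = true := by
  decide +kernel

/-- Certificate: columns `≤ 3` carry `≤ 11`. [kernel decision] -/
theorem kbCol3_true : kbCellLe 74 3 11 = true := by
  decide +kernel

/-- Certificate: rows `≤ 22` (min-depth `< 104.5`) carry `≤ 2.4`. [kernel decision] -/
theorem kbRows22_true : kbCellLe 22 12 (12 / 5) = true := by
  decide +kernel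

/-- Certificate: the cumulative column maxima are dominated by the two-hole line excess, key columns `2 … 9`. [kernel decision] -/
theorem kbCum_true : kbCum = true := by
  decide +kernel

/-- Line-excess entry `E(2, 3) = 18`. [kernel decision] -/
theorem kb_lineE1_2 : (lineExcessRows.getD 1 []).getD 2 0 = 18 := by
  decide +kernel

/-- Line-excess entry `E(7, 3) = 26.9`. [kernel decision] -/
theorem kb_lineE1_7 : (lineExcessRows.getD 1 []).getD 7 0 = 269 / 10 := by
  decide +kernel

/-- Line-excess entry `E(8, 3) = 35.3`. [kernel decision] -/
theorem kb_lineE1_8 : (lineExcessRows.getD 1 []).getD 8 0 = 353 / 10 := by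
  decide +kernel

/-- Line-excess entry `E(9, 3) = 44.3`. [kernel decision] -/
theorem kb_lineE1_9 : (lineExcessRows.getD 1 []).getD 9 0 = 443 / 10 := by
  decide +kernel

/-- Line-excess entry `E(10, 2) = 2.6`. [kernel decision] -/
theorem kb_lineE0_10 : (lineExcessRows.getD 0 []).getD 10 0 = 13 / 5 := by
  decide +kernel

/-- Reading a cell certificate. [formal bookkeeping] -/
theorem kb_cell_le {rmax cmax : ℕ} {M : ℚ} (h : kbCellLe rmax cmax M = true) {r c : ℕ} (hr : r ≤ rmax) (hc : c ≤ cmax) :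
    (capKRows.getD r []).getD c 0 ≤ M := by
  unfold kbCellLe at h
  rw [List.all_eq_true] at h
  have h1 := h r (List.mem_range.2 (by omega))
  rw [List.all_eq_true] at h1
  exact of_decide_eq_true (h1 c (List.mem_range.2 (by omega)))

/-- The table row index is at most `74`. [formal bookkeeping] -/
theorem kb_capKRow_le (d : ℝ) : capKRow d ≤ 74 := by
  unfold capKRow
  split_ifs with h1 h2
  · omega
  · rw [not_lt] at h1
    have : ⌊(d - 187 / 2) * 2⌋₊ < 73 := (Nat.floor_lt (by linarith)).2 (by push_cast; linarith)
    omega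
  · exact le_rfl

/-- The table column index is at most `12`. [formal bookkeeping] -/
theorem kb_capKCol_le (J : ℝ) : capKCol J ≤ 12 := by
  unfold capKCol
  split_ifs with h1 h2 h3
  · omega
  · omega
  · rw [not_lt] at h2
    have : ⌊(J - 1) * 10⌋₊ < 10 := (Nat.floor_lt (by linarith)).2 (by push_cast; linarith)
    omega
  · exact le_rfl

/-- From a cell certificate to the real-valued charge. [formal bookkeeping] -/
theorem kb_capK_le_cell (d J : ℝ) {M : ℚ} (hM : 0 ≤ M) {rmax cmax : ℕ} (h : kbCellLe rmax cmax M = true)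
    (hr : capKRow d ≤ rmax) (hc : capKCol J ≤ cmax) : capK d J ≤ (M : ℝ) := by
  unfold capK
  split_ifs
  · exact_mod_cast hM
  · exact max_le (by exact_mod_cast hM) (by exact_mod_cast kb_cell_le h hr hc)

/-- ★ TABLE FACT 1: a hole of kink column `≤ 2` carries `≤ 8.4`. -/
theorem kb_capK_le_col_two (d J : ℝ) (hc : capKCol J ≤ 2) : capK d J ≤ 42 / 5 := by
  have h := kb_capK_le_cell d J (by norm_num) kbCol2_true (kb_capKRow_le d) hc
  push_cast at h
  exact h

/-- ★ TABLE FACT 2: a hole of kink column `≤ 3` carries `≤ 11`. -/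
theorem kb_capK_le_col_three (d J : ℝ) (hc : capKCol J ≤ 3) : capK d J ≤ 11 := by
  have h := kb_capK_le_cell d J (by norm_num) kbCol3_true (kb_capKRow_le d) hc
  push_cast at h
  exact h

/-- ★ TABLE FACT 3: a hole of min-depth `< 104.5` carries `≤ 2.4`. -/
theorem kb_capK_le_shallow (d J : ℝ) (hd : d < 209 / 2) : capK d J ≤ 12 / 5 := by
  have hr : capKRow d ≤ 22 := kb_capKRow_le_of_lt d 22 (by norm_num) (by push_cast; linarith)
  have h := kb_capK_le_cell d J (by norm_num) kbRows22_true hr (kb_capKCol_le J)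
  push_cast at h
  exact h

/-- ★ TABLE FACT 4: for key columns `j = 2 … 9`, a hole of kink column `≤ j` carries at most the two-hole line excess `E(j, 2)`. -/
theorem kb_capK_le_lineExcess_two (d J : ℝ) {j : ℕ} (hj2 : 2 ≤ j) (hj9 : j ≤ 9) (hc : capKCol J ≤ j) :
    capK d J ≤ lineExcess j 2 := by
  have hcert : kbCellLe 74 j ((lineExcessRows.getD 0 []).getD j 0) = true := by
    have h := kbCum_true
    unfold kbCum at h
    rw [List.all_eq_true] at h
    have h1 := h (j - 2) (List.mem_range.2 (by omega))
    rwa [show j - 2 + 2 = j by omega] at h1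
  have hE : lineExcess j 2 = max 0 ((((lineExcessRows.getD 0 []).getD j 0 : ℚ)) : ℝ) := by
    unfold lineExcess
    rw [if_neg (by omega), if_pos rfl]
  rw [hE]
  unfold capK
  split_ifs
  · exact le_max_left _ _
  · exact max_le_max le_rfl (by exact_mod_cast kb_cell_le hcert (kb_capKRow_le d) hc)

/-- TABLE FACT 5a: `E(2, 3) = 18`. -/
theorem kb_lineExcess_two_three : lineExcess 2 3 = 18 := by
  unfold lineExcess
  rw [if_neg (by omega), if_neg (by omega), kb_lineE1_2]
  push_cast
  exact max_eq_right (by norm_num)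

/-- TABLE FACT 5b: `E(j, 3) ≥ 26.9` for `j = 7, 8, 9`. -/
theorem kb_lineExcess_three_ge (j : ℕ) (hj7 : 7 ≤ j) (hj9 : j ≤ 9) : (269 / 10 : ℝ) ≤ lineExcess j 3 := by
  unfold lineExcess
  rw [if_neg (by omega), if_neg (by omega)]
  interval_cases j
  · rw [kb_lineE1_7]; push_cast; exact le_max_right _ _
  · rw [kb_lineE1_8]; push_cast; exact le_trans (by norm_num) (le_max_right _ _)
  · rw [kb_lineE1_9]; push_cast; exact le_trans (by norm_num) (le_max_right _ _)

/-- TABLE FACT 5c: `E(10, 2) = 2.6`. -/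
theorem kb_lineExcess_ten_two : lineExcess 10 2 = 13 / 5 := by
  unfold lineExcess
  rw [if_neg (by omega), if_pos rfl, kb_lineE0_10]
  push_cast
  exact max_eq_right (by norm_num)

end Tables

/-! ## §B2 The two residual statements beneath (F_lo) -/

section Leaves

/-- ★ **(F₂¹⁰) TWO MARKED HOLES, KEY COLUMN `10`**: a marked fibre with exactly two marked positions whose key has kink column `10` (`1.8 ≤ kink <
1.9`) carries at most `E(10, 2) = 2.6` off the key.  PROVED in file C (`fibreChargeTwoTenQ_holds`, any `0 < ρlo`, `ρhi ≤ 1`): the key's kink forces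
a first squared-depth increment `≤ −0.8ρ(e₀ + e₁)`, the second hole needs a non-negative increment (pair budget ⇒ distance `≥ 0.4(e₀+e₁)/ρ`), and the
discrete parabola over the window `≤ (160 + 2ρ)/ρ` then caps the second hole's depth at `√10694 < 104.5`, where the table carries `≤ 2.4`.
[1D · stated for the record; not a leaf] -/
def FibreChargeTwoTenQ (R_N ρlo ρhi : ℝ) : Prop :=
  ∀ ρ : ℝ, ρlo ≤ ρ → ρ ≤ ρhi → ∀ (e m : ℤ → ℝ) (S : Finset ℤ) (t₀ : ℤ), IsMarkedFibre R_N ρ e m S t₀ →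
    capKCol (kink1 ρ e t₀) = 10 → S.card = 2 →
    ∑ t ∈ S, capK (m t) (kink1 ρ e t) ≤ capK (m t₀) (kink1 ρ e t₀) + lineExcess (capKCol (kink1 ρ e t₀)) S.card

/-- ★★★ **(F₃) THREE MARKED HOLES, KEY COLUMN `3 … 6`** — the residual TABLE leaf of NODE 84: a marked fibre (`R_N`, spacing `ρ ∈ [ρlo, ρhi]`)
with exactly THREE marked positions whose key has kink column `3 … 6` (`1.1 ≤ kink < 1.5`) carries at most `E(j, 3) = 18, 16.7, 18.7, 23.2` off the
key.  What is known (file A): the three holes `t₁ < t₂ < t₃` obey `m₂k₂ + m₁(k₁ − 1) + m₃(k₃ − 1) ≤ 160` and the pairwise parabola bounds; the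
linear budget ALONE allows `22 / 31.2 / 26.6 / 24` (`num/l3check.py`: two deep outer holes of columns `3–4` at rows `46–49`), so the depth profile
between the holes (descent from a deep outer hole to a shallow middle key at slope `≤ 0.2ρ` inside the window) is what closes it — exactly the
state space of the census DP.  [TABLE · 1D optimal control, THREE holes, key column `3–6` only · TRUE-leaning (NODE 82 grid DP, margin `×1.05 +
0.3`) · INSTRUMENTABLE (census-1 «FLO-83» restricted to `|S| = 3`, key columns `3–6`: exact-rational interval DP) · ATTACKABLE-S (parabola endgame as
in file C, per key position, four columns) — why it might fail: only by a grid artefact of NODE 82's `E(j,3)` in columns `3–6` (a profile threading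
rows `45–50` between two kinks more profitably than the `0.05`-grid found), which the restricted interval DP exposes cell by cell] -/
def FibreChargeThreeMidQ (R_N ρlo ρhi : ℝ) : Prop :=
  ∀ ρ : ℝ, ρlo ≤ ρ → ρ ≤ ρhi → ∀ (e m : ℤ → ℝ) (S : Finset ℤ) (t₀ : ℤ), IsMarkedFibre R_N ρ e m S t₀ →
    3 ≤ capKCol (kink1 ρ e t₀) → capKCol (kink1 ρ e t₀) ≤ 6 → S.card = 3 →
    ∑ t ∈ S, capK (m t) (kink1 ρ e t) ≤ capK (m t₀) (kink1 ρ e t₀) + lineExcess (capKCol (kink1 ρ e t₀)) S.card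

end Leaves

/-! ## §B3 The case analysis: (F_lo) ⟸ (F₂¹⁰) ∧ (F₃) -/

section Cases

variable {R_N ρ : ℝ} {e m : ℤ → ℝ} {S : Finset ℤ} {t₀ : ℤ}

/-- Splitting a two-element marked set off its key. [formal bookkeeping] -/
theorem kb_sum_two (hS : S.card = 2) (ht₀ : t₀ ∈ S) (f : ℤ → ℝ) :
    ∃ u, u ∈ S ∧ u ≠ t₀ ∧ ∑ t ∈ S, f t = f t₀ + f u := by
  have hE : (S.erase t₀).card = 1 := by rw [Finset.card_erase_of_mem ht₀]; omega
  obtain ⟨x, hxS⟩ := Finset.card_eq_one.1 hE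
  have hx : x ∈ S.erase t₀ := by rw [hxS]; simp
  rw [Finset.mem_erase] at hx
  exact ⟨x, hx.2, hx.1, by rw [← Finset.add_sum_erase S f ht₀, hxS, Finset.sum_singleton]⟩

/-- Splitting a three-element marked set off its key, the two other positions in increasing order. [formal bookkeeping] -/
theorem kb_sum_three (hS : S.card = 3) (ht₀ : t₀ ∈ S) (f : ℤ → ℝ) :
    ∃ u v, u ∈ S ∧ v ∈ S ∧ u ≠ t₀ ∧ v ≠ t₀ ∧ u < v ∧ ∑ t ∈ S, f t = f t₀ + f u + f v := by
  have hE : (S.erase t₀).card = 2 := by rw [Finset.card_erase_of_mem ht₀]; omega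
  obtain ⟨x, y, hxy, hxyS⟩ := Finset.card_eq_two.1 hE
  have hx : x ∈ S.erase t₀ := by rw [hxyS]; simp
  have hy : y ∈ S.erase t₀ := by rw [hxyS]; simp
  rw [Finset.mem_erase] at hx hy
  have hsum : ∑ t ∈ S, f t = f t₀ + (f x + f y) := by
    rw [← Finset.add_sum_erase S f ht₀, hxyS, Finset.sum_pair hxy]
  rcases lt_or_gt_of_ne hxy with h | h
  · exact ⟨x, y, hx.2, hy.2, hx.1, hy.1, h, by rw [hsum]; ring⟩
  · exact ⟨y, x, hy.2, hx.2, hy.1, hx.1, h, by rw [hsum]; ring⟩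

/-- A hole whose excess kink is cheap (`m·(kink − 1) ≤ 19.75`) carries `≤ 11`: either its column is `≤ 3`, or its kink is `≥ 1.2` and then its
min-depth is `≤ 98.75 < 104.5`. -/
theorem kb_charge_le_eleven (hρ : 0 < ρ) (hF : IsMarkedFibre R_N ρ e m S t₀) {t : ℤ} (ht : t ∈ S)
    (hb : m t * (kink1 ρ e t - 1) ≤ 79 / 4) : capK (m t) (kink1 ρ e t) ≤ 11 := by
  obtain ⟨hmt, -⟩ := kb_hole hρ hF ht
  by_cases hc : 4 ≤ capKCol (kink1 ρ e t)
  · have hk := kb_le_of_capKCol _ 4 (by norm_num) (by norm_num) hc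
    norm_num at hk
    have h1 : m t * (1 / 5) ≤ m t * (kink1 ρ e t - 1) := mul_le_mul_of_nonneg_left (by linarith) (by linarith)
    have h2 := kb_capK_le_shallow (m t) (kink1 ρ e t) (by linarith)
    linarith
  · rw [not_le] at hc
    exact kb_capK_le_col_three _ _ (by omega)

/-- A hole whose full kink is cheap (`m·kink ≤ 113.25`) carries `≤ 8.4`: either its column is `≤ 2`, or its kink is `≥ 1.1` and then its min-depth
is `< 103 < 104.5`. -/
theorem kb_charge_le_mk (hρ : 0 < ρ) (hF : IsMarkedFibre R_N ρ e m S t₀) {t : ℤ} (ht : t ∈ S)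
    (hb : m t * kink1 ρ e t ≤ 453 / 4) : capK (m t) (kink1 ρ e t) ≤ 42 / 5 := by
  obtain ⟨hmt, -⟩ := kb_hole hρ hF ht
  by_cases hc : 3 ≤ capKCol (kink1 ρ e t)
  · have hk := kb_le_of_capKCol _ 3 (by norm_num) (by norm_num) hc
    norm_num at hk
    have h1 : m t * (11 / 10) ≤ m t * kink1 ρ e t := mul_le_mul_of_nonneg_left (by linarith) (by linarith)
    have h2 := kb_capK_le_shallow (m t) (kink1 ρ e t) (by linarith)
    linarith
  · rw [not_le] at hc
    exact kb_capK_le_col_two _ _ (by omega)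

/-- ★ THE THREE POSITIONS OF THE KEY: for the two non-key holes `u < v` of a three-hole marked fibre, the three-hole budget of file A reads — key in
the middle: `93.5·k₀ + m_u(k_u − 1) + m_v(k_v − 1) ≤ 160`; key first: `93.5(k₀ − 1) + m_u k_u + m_v(k_v − 1) ≤ 160`; key last: `93.5(k₀ − 1) +
m_v k_v + m_u(k_u − 1) ≤ 160`. -/
theorem kb_three_positions (hρ : 0 < ρ) (hF : IsMarkedFibre 80 ρ e m S t₀) {u v : ℤ} (hu : u ∈ S) (hv : v ∈ S) (hut : u ≠ t₀)
    (hvt : v ≠ t₀) (huv : u < v) :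
    187 / 2 * kink1 ρ e t₀ + m u * (kink1 ρ e u - 1) + m v * (kink1 ρ e v - 1) ≤ 160 ∨
      187 / 2 * (kink1 ρ e t₀ - 1) + m u * kink1 ρ e u + m v * (kink1 ρ e v - 1) ≤ 160 ∨
      187 / 2 * (kink1 ρ e t₀ - 1) + m v * kink1 ρ e v + m u * (kink1 ρ e u - 1) ≤ 160 := by
  have ht₀ : t₀ ∈ S := hF.2.2.2.2.2.2.1
  obtain ⟨hm0, -, hk0, -⟩ := kb_hole hρ hF ht₀
  have hmk0 : 187 / 2 * kink1 ρ e t₀ ≤ m t₀ * kink1 ρ e t₀ := mul_le_mul_of_nonneg_right hm0 (by linarith)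
  have hmk0' : 187 / 2 * (kink1 ρ e t₀ - 1) ≤ m t₀ * (kink1 ρ e t₀ - 1) := mul_le_mul_of_nonneg_right hm0 (by linarith)
  rcases lt_or_gt_of_ne hut with h1 | h1
  · rcases lt_or_gt_of_ne hvt with h2 | h2
    · have h := kb_three_budget hρ hF hu hv ht₀ huv h2
      right; right; linarith
    · have h := kb_three_budget hρ hF hu ht₀ hv h1 h2
      left; linarith
  · have h := kb_three_budget hρ hF ht₀ hu hv h1 huv
    right; left; linarith

/-- ★ REGIME I: key column `≥ 7` (`k₀ ≥ 1.5`) and three holes — the two non-key holes carry `≤ 22` in total (key in the middle: both outer excess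
kinks cost `≤ 19.75`, so `≤ 11` each; key outside: the middle hole's full kink costs `≤ 113.25` (`≤ 8.4`) and the far hole's excess `≤ 19.75` (`≤ 11`)). -/
theorem kb_three_nonkey_le (hρ : 0 < ρ) (hF : IsMarkedFibre 80 ρ e m S t₀) (hj7 : 7 ≤ capKCol (kink1 ρ e t₀)) {u v : ℤ} (hu : u ∈ S)
    (hv : v ∈ S) (hut : u ≠ t₀) (hvt : v ≠ t₀) (huv : u < v) :
    capK (m u) (kink1 ρ e u) + capK (m v) (kink1 ρ e v) ≤ 22 := by
  have hk0 : 3 / 2 ≤ kink1 ρ e t₀ := by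
    have h := kb_le_of_capKCol _ 7 (by norm_num) (by norm_num) hj7
    norm_num at h
    linarith
  obtain ⟨hmu, -, hku, -⟩ := kb_hole hρ hF hu
  obtain ⟨hmv, -, hkv, -⟩ := kb_hole hρ hF hv
  have nu : 0 ≤ m u * (kink1 ρ e u - 1) := mul_nonneg (by linarith) (by linarith)
  have nv : 0 ≤ m v * (kink1 ρ e v - 1) := mul_nonneg (by linarith) (by linarith)
  have pu : 187 / 2 ≤ m u * kink1 ρ e u := by nlinarith
  have pv : 187 / 2 ≤ m v * kink1 ρ e v := by nlinarith
  rcases kb_three_positions hρ hF hu hv hut hvt huv with h | h | h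
  · have h1 := kb_charge_le_eleven hρ hF hu (by linarith)
    have h2 := kb_charge_le_eleven hρ hF hv (by linarith)
    linarith
  · have h1 := kb_charge_le_mk hρ hF hu (by linarith)
    have h2 := kb_charge_le_eleven hρ hF hv (by linarith)
    linarith
  · have h1 := kb_charge_le_mk hρ hF hv (by linarith)
    have h2 := kb_charge_le_eleven hρ hF hu (by linarith)
    linarith

/-- ★ REGIME II: key column `≥ 10` (`k₀ ≥ 1.8`) and three marked holes is impossible (`93.5 × 1.8 = 168.3 > 160` with the key in the middle;
`93.5 × 0.8 + 93.5 = 168.3 > 160` with the key outside). -/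
theorem kb_three_absurd (hρ : 0 < ρ) (hF : IsMarkedFibre 80 ρ e m S t₀) (hj10 : 10 ≤ capKCol (kink1 ρ e t₀)) {u v : ℤ} (hu : u ∈ S)
    (hv : v ∈ S) (hut : u ≠ t₀) (hvt : v ≠ t₀) (huv : u < v) : False := by
  have hk0 : 9 / 5 ≤ kink1 ρ e t₀ := by
    have h := kb_le_of_capKCol _ 10 (by norm_num) (by norm_num) hj10
    norm_num at h
    linarith
  obtain ⟨hmu, -, hku, -⟩ := kb_hole hρ hF hu
  obtain ⟨hmv, -, hkv, -⟩ := kb_hole hρ hF hv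
  have nu : 0 ≤ m u * (kink1 ρ e u - 1) := mul_nonneg (by linarith) (by linarith)
  have nv : 0 ≤ m v * (kink1 ρ e v - 1) := mul_nonneg (by linarith) (by linarith)
  have pu : 187 / 2 ≤ m u * kink1 ρ e u := by nlinarith
  have pv : 187 / 2 ≤ m v * kink1 ρ e v := by nlinarith
  rcases kb_three_positions hρ hF hu hv hut hvt huv with h | h | h
  · linarith
  · linarith
  · linarith

/-- ★★★ **(F_lo) ⟸ (F₂¹⁰) ∧ (F₃)** (PROVED; `R_N = 80`, any `0 < ρlo`): the one-fibre charge inequality for key columns `≤ 10` follows from the two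
residual statements.  One marked hole: the line excess is `≥ 0`.  Two: the other hole's column is at most the key's, so for key columns `2 … 9` it
carries at most the cumulative column maximum `≤ E(j, 2)` (table fact 4); key column `10` is (F₂¹⁰).  Three: key column `2` — both others are of
column `≤ 2`, `2 × 8.4 ≤ 18 = E(2, 3)`; `3 … 6` is (F₃); `7 … 9` — regime I, `22 ≤ 26.9 ≤ E(j, 3)`; `10` — regime II.  Four or more: `kb_card_le_three`. -/
theorem fibreChargeLowQ_of_kinkBudget {ρlo ρhi : ℝ} (hlo : 0 < ρlo) (h2 : FibreChargeTwoTenQ 80 ρlo ρhi)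
    (h3 : FibreChargeThreeMidQ 80 ρlo ρhi) : FibreChargeLowQ 80 ρlo ρhi := by
  intro ρ hρlo hρhi e m S t₀ hF hcol
  have hρ : 0 < ρ := lt_of_lt_of_le hlo hρlo
  have ht₀ : t₀ ∈ S := hF.2.2.2.2.2.2.1
  have hkle : ∀ t ∈ S, capKCol (kink1 ρ e t) ≤ capKCol (kink1 ρ e t₀) := by
    intro t ht
    apply kb_capKCol_mono
    rcases hF.2.2.2.2.2.2.2 t ht with h | ⟨h, -⟩
    · exact h.le
    · exact h.le
  have hj2 : 2 ≤ capKCol (kink1 ρ e t₀) := (hF.2.2.2.2.2.1 t₀ ht₀).2.1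
  have hcard3 := kb_card_le_three hρ hF
  have hcard0 : 0 < S.card := Finset.card_pos.2 ⟨t₀, ht₀⟩
  rcases (show S.card = 1 ∨ S.card = 2 ∨ S.card = 3 by omega) with hc1 | hc2 | hc3
  · -- one marked hole
    obtain ⟨a, ha⟩ := Finset.card_eq_one.1 hc1
    have hat : a = t₀ := by rw [ha] at ht₀; exact (Finset.mem_singleton.1 ht₀).symm
    rw [ha, Finset.sum_singleton, Finset.card_singleton, hat]
    exact le_add_of_nonneg_right (lineExcess_nonneg _ _)
  · -- two marked holes
    by_cases hj9 : capKCol (kink1 ρ e t₀) ≤ 9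
    · obtain ⟨u, hu, -, hsum⟩ := kb_sum_two hc2 ht₀ (fun t => capK (m t) (kink1 ρ e t))
      rw [hsum, hc2]
      have h := kb_capK_le_lineExcess_two (m u) (kink1 ρ e u) hj2 hj9 (hkle u hu)
      linarith
    · exact h2 ρ hρlo hρhi e m S t₀ hF (by omega) hc2
  · -- three marked holes
    by_cases hjmid : 3 ≤ capKCol (kink1 ρ e t₀) ∧ capKCol (kink1 ρ e t₀) ≤ 6
    · exact h3 ρ hρlo hρhi e m S t₀ hF hjmid.1 hjmid.2 hc3
    obtain ⟨u, v, hu, hv, hut, hvt, huv, hsum⟩ := kb_sum_three hc3 ht₀ (fun t => capK (m t) (kink1 ρ e t))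
    by_cases hjtwo : capKCol (kink1 ρ e t₀) ≤ 2
    · -- key column 2: both other holes are of column ≤ 2
      have hj : capKCol (kink1 ρ e t₀) = 2 := le_antisymm hjtwo hj2
      have hu' := kb_capK_le_col_two (m u) (kink1 ρ e u) ((hkle u hu).trans hjtwo)
      have hv' := kb_capK_le_col_two (m v) (kink1 ρ e v) ((hkle v hv).trans hjtwo)
      rw [hsum, hc3, hj, kb_lineExcess_two_three]
      linarith
    · have hj7 : 7 ≤ capKCol (kink1 ρ e t₀) := by omega
      by_cases hj9 : capKCol (kink1 ρ e t₀) ≤ 9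
      · -- regime I
        have h22 := kb_three_nonkey_le hρ hF hj7 hu hv hut hvt huv
        have hE := kb_lineExcess_three_ge (capKCol (kink1 ρ e t₀)) hj7 hj9
        rw [hsum, hc3]
        linarith
      · -- regime II
        exact (kb_three_absurd hρ hF (by omega) hu hv hut hvt huv).elim

end Cases

end Summit.AtomisticToContinuum.Crystallization.Theorems.ChargedEnergyGapChartDial
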